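import Summits.BirchSwinnertonDyer.BirchSwinnertonDyer.Theorems.ResidualThetaTransportAtTwoThetaLayerLambdaCongruenceAtTwoDoubling
import Literature.NumberTheory.EllipticCurves.PAdicLFunctionTameDepletionFactorProofs
import Literature.NumberTheory.EllipticCurves.PAdicMeasureUnsmoothingProofs
import HarnessLib

/-!
# Crux `ThetaLayerLambdaCongruenceAtTwo` (stmt-BirchSwinnertonDyer-20688, route ResidualThetaTransportAtTwo), line
# `birth`: the DEPLETION IDENTITY at the layers — the `S₀`-depleted layer element of the crux is the layer sum of the
# `S₀`-DEPLETED PLUS SYMBOL (width prover bsd-wall-rtt-p3-w2 g0; `--supports stmt-BirchSwinnertonDyer-20688 --as helper`;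
# closes nothing)

HONEST FRAMING. THEOREMS of the tree's definitions only (finite group-ring algebra + the Teichmüller decomposition
`ℓ ≡ ω(ℓ)·γ^{f_ℓ}`); nothing about any curve or form is asserted; BSD is not proved by any of this.

WHAT. Write `ϑ_n(ψ) = ∑_{s mod 2ⁿ} ψ(5^s/2^{n+2}) (1+X)^s` for the (single-count) layer sum of an even, `1`-periodic function
`ψ : ℚ → R` (the tree's `θ_n = C 2 · ϑ_n([·]⁺)` at `p = 2`, `mazurTateElementK_two`). For an odd `m` with Teichmüller
decomposition `m ≡ ω γ^F (mod 2^{n+2})`, `ω = ±1`, `γ = 5` (`exists_teichmuller_frobeniusExponent`), the layer sum of the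
DILATED function `x ↦ ψ(m x)` is `(1+X)^{−F} · ϑ_n(ψ)` modulo `ω_n = (1+X)^{2ⁿ} − 1` (§2: evenness kills `ω`, periodicity
of `ψ` and `γ^{2ⁿ} ≡ 1` re-index the sum). Consequently (§3), for any finite set `S₀` of odd places and any polynomials
`P_v` of degree `≤ d`, the crux's depletion factor `∏_{v∈S₀} P_v ∘ (ℓ_v⁻¹ (1+X)^{e_v})`, `e_v = (−f_{ℓ_v}) mod 2ⁿ`, acts on
`ϑ_n(ψ)` modulo `ω_n` as the DEPLETION OPERATOR `∏_v P_v(ℓ_v⁻¹ [ℓ_v])` acts on `ψ` (`[m]ψ(x) = ψ(m x)`):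

  `ϑ_n(ψ) · ∏_v P_v ∘ (ℓ_v⁻¹(1+X)^{e_v}) ≡ ϑ_n(ψ^{S₀})  (mod ω_n)`,
  `ψ^{S₀}(x) = ∑_{k : S₀ → {0..d}} (∏_v coeff_{k_v}(P_v) ℓ_v^{−k_v}) · ψ(x · ∏_v ℓ_v^{k_v})`

— the finite-layer form of `θ_n(f_{S₀}) = θ_n(f) · ∏_ℓ P_ℓ(ℓ⁻¹σ_ℓ⁻¹)` for the depleted form `f_{S₀} = f | ∏(1 − a_ℓ ℓ⁻¹[ℓ] + …)`
(Greenberg–Vatsal §1 display (8); Matsuno 2000 Lemma 3.3 at the layers). Since `deg ϑ_n < 2ⁿ`, the reduced element is the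
layer sum of the depleted function EXACTLY (companion file `…DepletionPartner.lean`): the partner's depleted layer element is
`Θ^{S₀}_n(g;Ω) = C 2 · ϑ_n(φ^{S₀}_{g,Ω})` with `φ_{g,Ω} = ι ∘ [·]⁺_{g,Ω}` and `P_v = 1 − ι a_{ℓ_v}(g) X + 𝟙_{ℓ_v∤M} ℓ_v X²`,
and likewise `Θ^{S₀}_n(W) = C 2 · ϑ_n(φ^{S₀}_W)` with `φ_W = [·]⁺_f` and `P_v = L_v(W, X)`. So the two research stubs of
skeleton v4 — (H♮) `‖C a·Θ_W − Θ_g‖_sup < ‖2‖₂` and (μ♮) `‖Θ_g‖_sup = ‖2‖₂` — are statements about the VALUES of the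
depleted plus symbols at the layer-`n` sample points `5^s/2^{n+2}` (through the group-ring isometry
`‖∑ c_s(1+X)^s‖_sup = max ‖c_s‖`, sibling seat rtt-p3-w3), which is where multiplicity one mod `2` lives.

References: [GreenbergVatsal2000] §1 p. 9 (display (8): `P_ℓ(ℓ⁻¹γ_ℓ⁻¹)`); [Matsuno2000] Lemma 3.3; [MazurTateTeitelbaum1986Invent]
§I.8, §I.13; [PollackWeston2011MT] §2.1 (2.1).
-/

noncomputable section

-- justification: the `Summit.BirchSwinnertonDyer.BirchSwinnertonDyer.…` path repeats a component (route-file convention)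
set_option linter.dupNamespace false

open scoped Classical

open Polynomial

open Literature.NumberTheory.IwasawaTheory Literature.NumberTheory.EllipticCurves
  Literature.NumberTheory.EllipticCurves.ModularForms

namespace Summit.BirchSwinnertonDyer.BirchSwinnertonDyer.Theorems.ThetaLayerLambdaCongruenceAtTwo

/-! ## §1. `(1+X)^a ≡ (1+X)^b (mod (1+X)^q − 1)` for `a ≡ b (mod q)` -/

section Modulus

variable {R : Type*} [CommRing R]

/-- `(X+1)^q − 1 ∣ (X+1)^a − (X+1)^{a + qk}`. [folklore] -/
theorem layerModulus_dvd_pow_sub_pow_add_mul (q a k : ℕ) :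
    ((X + 1) ^ q - 1 : R[X]) ∣ (X + 1) ^ a - (X + 1) ^ (a + q * k) := by
  have h : ((X + 1) ^ q - 1 : R[X]) ∣ ((X + 1) ^ q) ^ k - 1 ^ k := sub_dvd_pow_sub_pow _ _ k
  rw [one_pow, ← pow_mul] at h
  have e : ((X + 1) ^ a - (X + 1) ^ (a + q * k) : R[X]) = -((X + 1) ^ a * ((X + 1) ^ (q * k) - 1)) := by ring
  rw [e]
  exact (dvd_mul_of_dvd_right h _).neg_right

/-- **`(X+1)^a ≡ (X+1)^b (mod (X+1)^q − 1)` whenever `a ≡ b (mod q)`** — in the layer group ring `R[X]/((X+1)^{pⁿ} − 1)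
= R[G_n]` the element `σ = X + 1` has order dividing `pⁿ`. [folklore] -/
theorem layerModulus_dvd_pow_sub_pow_of_modEq {q a b : ℕ} (h : a ≡ b [MOD q]) :
    ((X + 1) ^ q - 1 : R[X]) ∣ (X + 1) ^ a - (X + 1) ^ b := by
  rcases le_total a b with hab | hab
  · obtain ⟨k, hk⟩ := (Nat.modEq_iff_dvd' hab).mp h
    have hb : b = a + q * k := by omega
    rw [hb]
    exact layerModulus_dvd_pow_sub_pow_add_mul q a k
  · obtain ⟨k, hk⟩ := (Nat.modEq_iff_dvd' hab).mp h.symm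
    have ha : a = b + q * k := by omega
    rw [ha, ← dvd_neg, neg_sub]
    exact layerModulus_dvd_pow_sub_pow_add_mul q b k

end Modulus

/-! ## §2. The layer sum of a dilated even periodic function: `ϑ_n([m]ψ) ≡ (1+X)^{−F}·ϑ_n(ψ)` -/

section Dilation

variable {R : Type*} [CommRing R]

/-- `γ^{t} = γ^{t mod 2ⁿ}` in `ℤ/2^{n+2}` (`γ = 5` has order `2ⁿ` there). [cite: MazurTateTeitelbaum1986Invent, §I.13] -/
theorem cyclotomicGenerator_two_pow_eq_pow_mod (n t : ℕ) :
    (cyclotomicGenerator 2 : ZMod (2 ^ (n + 2))) ^ t =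
      (cyclotomicGenerator 2 : ZMod (2 ^ (n + 2))) ^ (t % 2 ^ n) := by
  have h1 : (cyclotomicGenerator 2 : ZMod (2 ^ (n + 2))) ^ 2 ^ n = 1 :=
    cyclotomicGenerator_pow_pow_eq_one (p := 2) n
  conv_lhs => rw [← Nat.div_add_mod t (2 ^ n), pow_add, pow_mul, h1, one_pow, one_mul]

omit [CommRing R] in
/-- The value `ψ(γ^t/2^{n+2})` depends on `t` only modulo `2ⁿ`. [cite: MazurTateTeitelbaum1986Invent, §I.13] -/
theorem apply_cyclotomicGenerator_pow_val_div_eq_mod (ψ : ℚ → R) (n t : ℕ) :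
    ψ ((((cyclotomicGenerator 2 : ZMod (2 ^ (n + 2))) ^ t).val : ℚ) / (2 : ℚ) ^ (n + 2)) =
      ψ ((((cyclotomicGenerator 2 : ZMod (2 ^ (n + 2))) ^ (t % 2 ^ n)).val : ℚ) / (2 : ℚ) ^ (n + 2)) := by
  rw [cyclotomicGenerator_two_pow_eq_pow_mod]

omit [CommRing R] in
/-- **Dilation by an odd `m` with Teichmüller decomposition `m ≡ ω γ^F (mod 2^{n+2})`, `ω = ±1`**: for an even,
`1`-periodic `ψ : ℚ → R`, `ψ(m · γ^s/2^{n+2}) = ψ(γ^{s+F}/2^{n+2})`. [cite: MazurTateTeitelbaum1986Invent, §I.13 (x = η γ^{ℓ(x)})] -/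
theorem apply_mul_cyclotomicGenerator_pow_val_div (ψ : ℚ → R) (hneg : ∀ x, ψ (-x) = ψ x)
    (hper : ∀ (x : ℚ) (k : ℤ), ψ (x + k) = ψ x) {n m F : ℕ} {ω : ZMod (2 ^ (n + 2))} (hω : ω = 1 ∨ ω = -1)
    (hm : (m : ZMod (2 ^ (n + 2))) = ω * (cyclotomicGenerator 2 : ZMod (2 ^ (n + 2))) ^ F) (s : ℕ) :
    ψ ((m : ℚ) * ((((cyclotomicGenerator 2 : ZMod (2 ^ (n + 2))) ^ s).val : ℚ) / (2 : ℚ) ^ (n + 2))) =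
      ψ ((((cyclotomicGenerator 2 : ZMod (2 ^ (n + 2))) ^ (s + F)).val : ℚ) / (2 : ℚ) ^ (n + 2)) := by
  -- the two numerators `A = m·(γ^s).val` and `B = (γ^{s+F}).val`
  obtain ⟨A, hA⟩ : ∃ A : ℕ, A = m * ((cyclotomicGenerator 2 : ZMod (2 ^ (n + 2))) ^ s).val := ⟨_, rfl⟩
  obtain ⟨B, hB⟩ : ∃ B : ℕ, B = ((cyclotomicGenerator 2 : ZMod (2 ^ (n + 2))) ^ (s + F)).val := ⟨_, rfl⟩
  obtain ⟨N, hN⟩ : ∃ N : ℕ, N = 2 ^ (n + 2) := ⟨_, rfl⟩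
  have hNq : ((2 : ℚ) ^ (n + 2)) = (N : ℚ) := by rw [hN]; push_cast; ring
  have hN0 : (N : ℚ) ≠ 0 := by rw [hN]; positivity
  have hAq : (m : ℚ) * ((((cyclotomicGenerator 2 : ZMod (2 ^ (n + 2))) ^ s).val : ℚ) / (2 : ℚ) ^ (n + 2)) =
      (A : ℚ) / (N : ℚ) := by
    rw [hA, hNq]; push_cast; ring
  have hBq : ((((cyclotomicGenerator 2 : ZMod (2 ^ (n + 2))) ^ (s + F)).val : ℚ) / (2 : ℚ) ^ (n + 2)) =
      (B : ℚ) / (N : ℚ) := by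
    rw [hB, hNq]
  rw [hAq, hBq]
  have hAcast : (A : ZMod (2 ^ (n + 2))) = ω * (B : ZMod (2 ^ (n + 2))) := by
    rw [hA, hB, Nat.cast_mul, ZMod.natCast_zmod_val, ZMod.natCast_zmod_val, hm,
      pow_add (cyclotomicGenerator 2 : ZMod (2 ^ (n + 2))) s F]
    ring
  rcases hω with rfl | rfl
  · -- `A ≡ B (mod N)`: the two arguments differ by an integer
    rw [one_mul, ← hN, ZMod.natCast_eq_natCast_iff] at hAcast
    obtain ⟨k, hk⟩ := Nat.modEq_iff_dvd.mp hAcast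
    have hk' : ((B : ℚ) - A) = (N : ℚ) * k := by exact_mod_cast hk
    have e : (A : ℚ) / N = (B : ℚ) / N + ((-k : ℤ) : ℚ) := by
      push_cast
      field_simp
      linear_combination -hk'
    rw [e, hper]
  · -- `A ≡ −B (mod N)`: the two arguments are opposite up to an integer
    have h0 : ((A + B : ℕ) : ZMod (2 ^ (n + 2))) = 0 := by rw [Nat.cast_add, hAcast]; ring
    rw [← hN, ZMod.natCast_eq_zero_iff] at h0
    obtain ⟨k, hk⟩ := h0
    have hk' : ((A : ℚ) + B) = (N : ℚ) * k := by exact_mod_cast hk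
    have e : (A : ℚ) / N = -((B : ℚ) / N) + ((k : ℕ) : ℤ) := by
      push_cast
      field_simp
      linear_combination hk'
    rw [e, hper, hneg]

/-- **Re-indexing the layer sum** (pure group-ring bookkeeping): for a `2ⁿ`-periodic coefficient sequence `c` and
`F + G ≡ 0 (mod 2ⁿ)`, `∑_s c(s+F)(1+X)^s ≡ (1+X)^G ∑_s c(s)(1+X)^s (mod (1+X)^{2ⁿ} − 1)` (substitute `s ↦ s + F`,
`(1+X)^{s} ≡ (1+X)^{s+F+G}`). [folklore] -/
theorem layerSum_shift_congr (c : ℕ → R) {n : ℕ} (hc : ∀ t, c t = c (t % 2 ^ n)) {F G : ℕ} (hFG : 2 ^ n ∣ F + G) :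
    ((X + 1) ^ 2 ^ n - 1 : R[X]) ∣
      (∑ s : ZMod (2 ^ n), C (c (s.val + F)) * (X + 1) ^ s.val) -
        (X + 1) ^ G * ∑ s : ZMod (2 ^ n), C (c s.val) * (X + 1) ^ s.val := by
  classical
  have hre : ∑ s : ZMod (2 ^ n), C (c s.val) * (X + 1 : R[X]) ^ s.val =
      ∑ s : ZMod (2 ^ n), C (c (s + (F : ZMod (2 ^ n))).val) * (X + 1) ^ (s + (F : ZMod (2 ^ n))).val := by
    rw [← Equiv.sum_comp (Equiv.addRight (F : ZMod (2 ^ n)))]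
    simp only [Equiv.coe_addRight]
  rw [hre, Finset.mul_sum, ← Finset.sum_sub_distrib]
  refine Finset.dvd_sum fun s _ ↦ ?_
  have hval : (s + (F : ZMod (2 ^ n))).val % 2 ^ n = (s.val + F) % 2 ^ n := by
    rw [ZMod.val_add, ZMod.val_natCast, Nat.mod_mod, Nat.add_mod, Nat.mod_mod, ← Nat.add_mod]
  have hc' : c (s + (F : ZMod (2 ^ n))).val = c (s.val + F) := by
    rw [hc (s + (F : ZMod (2 ^ n))).val, hc (s.val + F), hval]
  have hexp : s.val ≡ G + (s + (F : ZMod (2 ^ n))).val [MOD 2 ^ n] := by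
    have h1 : G + (s + (F : ZMod (2 ^ n))).val ≡ G + (s.val + F) [MOD 2 ^ n] := (Nat.ModEq.refl G).add hval
    have h2 : s.val + (F + G) ≡ s.val + 0 [MOD 2 ^ n] :=
      (Nat.ModEq.refl _).add (Nat.modEq_zero_iff_dvd.mpr hFG)
    rw [add_zero] at h2
    have h3 : G + (s.val + F) = s.val + (F + G) := by ring
    rw [h3] at h1
    exact (h1.trans h2).symm
  rw [hc', ← mul_assoc, mul_comm ((X + 1 : R[X]) ^ G) (C _), mul_assoc, ← pow_add, ← mul_sub]
  exact dvd_mul_of_dvd_right (layerModulus_dvd_pow_sub_pow_of_modEq hexp) _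

/-- **The layer sum of a dilated function**: for `ψ : ℚ → R` even and `1`-periodic and an odd `m` with
`m ≡ ω γ^F (mod 2^{n+2})`, `ω = ±1`, and any `G` with `F + G ≡ 0 (mod 2ⁿ)`,
`∑_s ψ(m·γ^s/2^{n+2})(1+X)^s ≡ (1+X)^G · ∑_s ψ(γ^s/2^{n+2})(1+X)^s (mod (1+X)^{2ⁿ} − 1)` — `ϑ_n([m]ψ) = σ_m⁻¹ ϑ_n(ψ)`
in `R[G_n]`, the finite-layer form of `θ_n(f | [ℓ]) = σ_ℓ⁻¹ θ_n(f)` (Greenberg–Vatsal §1 (8); Matsuno Lemma 3.3).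
[cite: GreenbergVatsal2000, §1 p. 9 (display (8))] -/
theorem layerSum_dilate_congr (ψ : ℚ → R) (hneg : ∀ x, ψ (-x) = ψ x) (hper : ∀ (x : ℚ) (k : ℤ), ψ (x + k) = ψ x)
    {n m F G : ℕ} {ω : ZMod (2 ^ (n + 2))} (hω : ω = 1 ∨ ω = -1)
    (hm : (m : ZMod (2 ^ (n + 2))) = ω * (cyclotomicGenerator 2 : ZMod (2 ^ (n + 2))) ^ F) (hFG : 2 ^ n ∣ F + G) :
    ((X + 1) ^ 2 ^ n - 1 : R[X]) ∣
      (∑ s : ZMod (2 ^ n), C (ψ ((m : ℚ) * ((((cyclotomicGenerator 2 : ZMod (2 ^ (n + 2))) ^ s.val).val : ℚ) /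
          (2 : ℚ) ^ (n + 2)))) * (X + 1) ^ s.val) -
        (X + 1) ^ G * ∑ s : ZMod (2 ^ n), C (ψ ((((cyclotomicGenerator 2 : ZMod (2 ^ (n + 2))) ^ s.val).val : ℚ) /
          (2 : ℚ) ^ (n + 2))) * (X + 1) ^ s.val := by
  have h1 : (∑ s : ZMod (2 ^ n), C (ψ ((m : ℚ) * ((((cyclotomicGenerator 2 : ZMod (2 ^ (n + 2))) ^ s.val).val : ℚ) /
        (2 : ℚ) ^ (n + 2)))) * (X + 1 : R[X]) ^ s.val) =
      ∑ s : ZMod (2 ^ n), C (ψ ((((cyclotomicGenerator 2 : ZMod (2 ^ (n + 2))) ^ (s.val + F)).val : ℚ) /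
        (2 : ℚ) ^ (n + 2))) * (X + 1) ^ s.val :=
    Finset.sum_congr rfl fun s _ ↦ by rw [apply_mul_cyclotomicGenerator_pow_val_div ψ hneg hper hω hm s.val]
  rw [h1]
  exact layerSum_shift_congr (fun t ↦ ψ ((((cyclotomicGenerator 2 : ZMod (2 ^ (n + 2))) ^ t).val : ℚ) /
    (2 : ℚ) ^ (n + 2))) (fun t ↦ apply_cyclotomicGenerator_pow_val_div_eq_mod ψ n t) hFG

end Dilation

/-! ## §3. Teichmüller data at `2` and the depletion identity modulo `ω_n` -/

section Depletion

/-- A product of signs is a sign. [folklore] -/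
theorem prod_eq_one_or_eq_neg_one {M : Type*} [CommRing M] {β : Type*} (s : Finset β) (u : β → M)
    (h : ∀ b ∈ s, u b = 1 ∨ u b = -1) : (∏ b ∈ s, u b) = 1 ∨ (∏ b ∈ s, u b) = -1 := by
  classical
  induction s using Finset.induction_on with
  | empty => exact Or.inl (by simp)
  | insert a s ha ih =>
    rw [Finset.prod_insert ha]
    rcases h a (Finset.mem_insert_self a s) with h1 | h1 <;>
      rcases ih (fun b hb ↦ h b (Finset.mem_insert_of_mem hb)) with h2 | h2 <;>
        simp [h1, h2]

/-- A power of a sign is a sign. [folklore] -/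
theorem pow_eq_one_or_eq_neg_one {M : Type*} [CommRing M] {u : M} (h : u = 1 ∨ u = -1) (k : ℕ) :
    u ^ k = 1 ∨ u ^ k = -1 := by
  rcases h with rfl | rfl
  · exact Or.inl (one_pow k)
  · rcases neg_one_pow_eq_or M k with h | h
    · exact Or.inl h
    · exact Or.inr h

/-- `x.val + (−x).val ≡ 0 (mod q)` in `ℤ/q`. [folklore] -/
theorem dvd_val_add_val_neg {q : ℕ} [NeZero q] (x : ZMod q) : q ∣ x.val + (-x).val := by
  rw [← ZMod.natCast_eq_zero_iff, Nat.cast_add, ZMod.natCast_zmod_val, ZMod.natCast_zmod_val, add_neg_cancel]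

/-- **Teichmüller decomposition of an odd `ℓ` at level `2^{n+2}`**: `ℓ ≡ ω · γ^{f_n(ℓ)} (mod 2^{n+2})` with `ω = ±1`
(the image of the Teichmüller representative, a root of unity of order dividing `2` in `ℤ₂`) and
`f_n(ℓ) = (f_ℓ mod 2ⁿ).val`, `f_ℓ = frobeniusExponent 2 ℓ` (tree theorem `exists_teichmuller_frobeniusExponent`).
[cite: GreenbergVatsal2000, §1 p. 9 (definition of f_ℓ)] -/
theorem exists_sign_mul_cyclotomicGenerator_pow_eq {ℓ : ℕ} (hℓ : ¬ 2 ∣ ℓ) (n : ℕ) :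
    ∃ ω : ZMod (2 ^ (n + 2)), (ω = 1 ∨ ω = -1) ∧
      (ℓ : ZMod (2 ^ (n + 2))) = ω * (cyclotomicGenerator 2 : ZMod (2 ^ (n + 2))) ^
        (PadicInt.toZModPow n (GreenbergVatsal2000.frobeniusExponent 2 (ℓ : ℤ_[2]))).val := by
  have hcop : ℓ.Coprime 2 := (Nat.Prime.coprime_iff_not_dvd Nat.prime_two).mpr hℓ |>.symm
  obtain ⟨teich, hteich⟩ := exists_teichmuller_frobeniusExponent (p := 2) hcop
  have hn : PadicInt.toZModPow (n + cyclotomicExponent 2) ((teich : ℤ_[2]ˣ) : ℤ_[2]) *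
      (cyclotomicGenerator 2 : ZMod (2 ^ (n + cyclotomicExponent 2))) ^
        (PadicInt.toZModPow n (GreenbergVatsal2000.frobeniusExponent 2 (ℓ : ℤ_[2]))).val =
      (ℓ : ZMod (2 ^ (n + cyclotomicExponent 2))) := hteich n
  refine ⟨PadicInt.toZModPow (n + 2) ((teich : ℤ_[2]ˣ) : ℤ_[2]), ?_, ?_⟩
  · -- the Teichmüller representative is `±1`
    have key : ∀ u : ℤ_[2]ˣ, u ^ torsionOrder 2 = 1 →
        PadicInt.toZModPow (n + 2) (u : ℤ_[2]) = 1 ∨ PadicInt.toZModPow (n + 2) (u : ℤ_[2]) = -1 := by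
      intro u hu
      rw [torsionOrder_two] at hu
      have hsq : ((u : ℤ_[2])) ^ 2 = 1 := by rw [← Units.val_pow_eq_pow_val, hu, Units.val_one]
      rcases sq_eq_one_iff.mp hsq with h | h
      · exact Or.inl (by rw [h, map_one])
      · exact Or.inr (by rw [h, map_neg, map_one])
    exact key _ ((mem_rootsOfUnity _ _).mp teich.2)
  · exact hn.symm

variable {K : Type*} [Field K]

/-- `P ∘ Q = ∑_{k ≤ d} coeff_k(P) · Q^k` for `deg P ≤ d`. [folklore] -/
theorem comp_eq_sum_range_of_natDegree_le {P : K[X]} {d : ℕ} (hd : P.natDegree ≤ d) (Q : K[X]) :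
    P.comp Q = ∑ k ∈ Finset.range (d + 1), C (P.coeff k) * Q ^ k := by
  rw [comp_eq_sum_left]
  exact P.sum_over_range' (fun k ↦ by rw [map_zero, zero_mul]) (d + 1) (Nat.lt_succ_of_le hd)

/-- **THE DEPLETION IDENTITY MODULO `ω_n`.** Let `ψ : ℚ → K` be even and `1`-periodic, `S` a finite set of indices
with ODD moduli `ℓ_a`, `P_a ∈ K[X]` polynomials of degree `≤ d` (the Euler factors), and `e_a = (−f_{ℓ_a}) mod 2ⁿ`
(`f_ℓ = frobeniusExponent 2 ℓ`, so that `(1+X)^{e_a} = σ_{ℓ_a}⁻¹` in the layer group ring). Then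

  `ϑ_n(ψ) · ∏_{a∈S} P_a ∘ (ℓ_a⁻¹ (1+X)^{e_a}) ≡ ϑ_n(ψ^{S})  (mod (1+X)^{2ⁿ} − 1)`,

where `ϑ_n(ψ) = ∑_{s mod 2ⁿ} ψ(γ^s/2^{n+2})(1+X)^s` and the `S`-DEPLETED function is
`ψ^{S}(x) = ∑_{k : S → {0,…,d}} (∏_a coeff_{k_a}(P_a)·ℓ_a^{−k_a}) · ψ(x · ∏_a ℓ_a^{k_a})` — i.e. the depletion operator
`∏_a P_a(ℓ_a⁻¹ [ℓ_a])`, `[m]ψ(x) = ψ(m x)`, applied to `ψ`. This is the finite-layer form of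
`θ_n(f | ∏_ℓ P_ℓ(ℓ⁻¹V_ℓ)) = θ_n(f) · ∏_ℓ P_ℓ(ℓ⁻¹σ_ℓ⁻¹)` (Greenberg–Vatsal §1 (8), the `Σ₀`-non-primitive
`p`-adic `L`-function; Matsuno 2000 Lemma 3.3). PROOF: expand the product over `k : S → {0..d}`
(`Finset.prod_univ_sum`); for each `k` the monomial `(1+X)^{∑ k_a e_a}` acts on `ϑ_n(ψ)` as the dilation by
`m_k = ∏ ℓ_a^{k_a}` (`layerSum_dilate_congr` with the Teichmüller data `ℓ_a ≡ ω_a γ^{f_a}` multiplied up).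
[cite: GreenbergVatsal2000, §1 p. 9 (display (8))] -/
theorem layerSum_mul_prod_eulerFactor_congr (ψ : ℚ → K) (hneg : ∀ x, ψ (-x) = ψ x)
    (hper : ∀ (x : ℚ) (k : ℤ), ψ (x + k) = ψ x) {α : Type*} (S : Finset α) (ℓ : α → ℕ)
    (hodd : ∀ a ∈ S, ¬ 2 ∣ ℓ a) (P : α → K[X]) {d : ℕ} (hd : ∀ a ∈ S, (P a).natDegree ≤ d) (n : ℕ) :
    ((X + 1) ^ 2 ^ n - 1 : K[X]) ∣
      (∑ s : ZMod (2 ^ n), C (ψ ((((cyclotomicGenerator 2 : ZMod (2 ^ (n + 2))) ^ s.val).val : ℚ) /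
          (2 : ℚ) ^ (n + 2))) * (X + 1) ^ s.val) *
        ∏ a ∈ S, (P a).comp (C ((ℓ a : K)⁻¹) * (X + 1) ^
          (PadicInt.toZModPow n (-(GreenbergVatsal2000.frobeniusExponent 2 (ℓ a : ℤ_[2])))).val) -
      ∑ s : ZMod (2 ^ n), C ((∑ k ∈ Fintype.piFinset (fun _ : S ↦ Finset.range (d + 1)),
          (∏ a : S, (P a).coeff (k a) * ((ℓ a : K)⁻¹) ^ (k a)) *
            ψ (((((cyclotomicGenerator 2 : ZMod (2 ^ (n + 2))) ^ s.val).val : ℚ) / (2 : ℚ) ^ (n + 2)) *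
              ((∏ a : S, ℓ a ^ (k a) : ℕ) : ℚ)))) * (X + 1) ^ s.val := by
  classical
  -- abbreviations: exponents `e a`, `f a`, the sample points and the layer sum of a dilation
  obtain ⟨e, he⟩ : ∃ e : α → ℕ, ∀ a, e a =
      (PadicInt.toZModPow n (-(GreenbergVatsal2000.frobeniusExponent 2 (ℓ a : ℤ_[2])))).val := ⟨_, fun _ ↦ rfl⟩
  obtain ⟨f, hf⟩ : ∃ f : α → ℕ, ∀ a, f a =
      (PadicInt.toZModPow n (GreenbergVatsal2000.frobeniusExponent 2 (ℓ a : ℤ_[2]))).val := ⟨_, fun _ ↦ rfl⟩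
  simp only [← he]
  -- Teichmüller signs
  have hteich : ∀ a ∈ S, ∃ ω : ZMod (2 ^ (n + 2)), (ω = 1 ∨ ω = -1) ∧
      (ℓ a : ZMod (2 ^ (n + 2))) = ω * (cyclotomicGenerator 2 : ZMod (2 ^ (n + 2))) ^ f a := by
    intro a ha
    rw [hf]
    exact exists_sign_mul_cyclotomicGenerator_pow_eq (hodd a ha) n
  choose! ω hω using hteich
  have hfe : ∀ a, 2 ^ n ∣ f a + e a := by
    intro a
    haveI : NeZero (2 ^ n) := ⟨pow_ne_zero _ two_ne_zero⟩
    rw [hf, he, map_neg]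
    exact dvd_val_add_val_neg _
  -- expand the product of Euler factors over `k : S → {0..d}`
  have hprod : ∏ a ∈ S, (P a).comp (C ((ℓ a : K)⁻¹) * (X + 1) ^ e a) =
      ∑ k ∈ Fintype.piFinset (fun _ : S ↦ Finset.range (d + 1)),
        C (∏ a : S, (P a).coeff (k a) * ((ℓ a : K)⁻¹) ^ (k a)) * (X + 1) ^ (∑ a : S, k a * e a) := by
    rw [← Finset.prod_coe_sort S]
    have hcomp : ∀ a : S, (P a).comp (C ((ℓ a : K)⁻¹) * (X + 1) ^ e a) =
        ∑ k ∈ Finset.range (d + 1), C ((P a).coeff k * ((ℓ a : K)⁻¹) ^ k) * (X + 1) ^ (k * e a) := by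
      intro a
      rw [comp_eq_sum_range_of_natDegree_le (hd a a.2)]
      refine Finset.sum_congr rfl fun k _ ↦ ?_
      rw [mul_pow, ← map_pow, ← pow_mul, ← mul_assoc, ← map_mul, mul_comm (e a) k]
    simp_rw [hcomp]
    rw [Finset.prod_univ_sum]
    refine Finset.sum_congr rfl fun k _ ↦ ?_
    rw [Finset.prod_mul_distrib, ← map_prod, Finset.prod_pow_eq_pow_sum]
  rw [hprod, Finset.mul_sum]
  -- the depleted layer sum, expanded over `k`
  have hdep : (∑ s : ZMod (2 ^ n), C ((∑ k ∈ Fintype.piFinset (fun _ : S ↦ Finset.range (d + 1)),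
          (∏ a : S, (P a).coeff (k a) * ((ℓ a : K)⁻¹) ^ (k a)) *
            ψ (((((cyclotomicGenerator 2 : ZMod (2 ^ (n + 2))) ^ s.val).val : ℚ) / (2 : ℚ) ^ (n + 2)) *
              ((∏ a : S, ℓ a ^ (k a) : ℕ) : ℚ)))) * (X + 1 : K[X]) ^ s.val) =
      ∑ k ∈ Fintype.piFinset (fun _ : S ↦ Finset.range (d + 1)),
        C (∏ a : S, (P a).coeff (k a) * ((ℓ a : K)⁻¹) ^ (k a)) *
          ∑ s : ZMod (2 ^ n), C (ψ (((∏ a : S, ℓ a ^ (k a) : ℕ) : ℚ) *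
            ((((cyclotomicGenerator 2 : ZMod (2 ^ (n + 2))) ^ s.val).val : ℚ) / (2 : ℚ) ^ (n + 2)))) *
              (X + 1) ^ s.val := by
    simp_rw [map_sum, Finset.sum_mul, map_mul]
    rw [Finset.sum_comm]
    refine Finset.sum_congr rfl fun k _ ↦ ?_
    rw [Finset.mul_sum]
    refine Finset.sum_congr rfl fun s _ ↦ ?_
    rw [mul_assoc, mul_comm (((((cyclotomicGenerator 2 : ZMod (2 ^ (n + 2))) ^ s.val).val : ℚ) /
      (2 : ℚ) ^ (n + 2)))]
  rw [hdep, ← Finset.sum_sub_distrib]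
  refine Finset.dvd_sum fun k hk ↦ ?_
  rw [mul_left_comm, ← mul_sub]
  refine dvd_mul_of_dvd_right ?_ _
  -- Teichmüller data for `m_k = ∏ ℓ_a^{k_a}`
  have hm : ((∏ a : S, ℓ a ^ (k a) : ℕ) : ZMod (2 ^ (n + 2))) =
      (∏ a : S, ω a ^ (k a)) * (cyclotomicGenerator 2 : ZMod (2 ^ (n + 2))) ^ (∑ a : S, k a * f a) := by
    rw [Nat.cast_prod, ← Finset.prod_pow_eq_pow_sum, ← Finset.prod_mul_distrib]
    refine Finset.prod_congr rfl fun a _ ↦ ?_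
    rw [Nat.cast_pow, (hω a a.2).2, mul_pow, ← pow_mul, mul_comm (f a) (k a)]
  have hsign : (∏ a : S, ω a ^ (k a)) = 1 ∨ (∏ a : S, ω a ^ (k a)) = -1 :=
    prod_eq_one_or_eq_neg_one _ _ fun a _ ↦ pow_eq_one_or_eq_neg_one (hω a a.2).1 _
  have hFG : 2 ^ n ∣ (∑ a : S, k a * f a) + ∑ a : S, k a * e a := by
    rw [← Finset.sum_add_distrib]
    exact Finset.dvd_sum fun a _ ↦ by rw [← mul_add]; exact (hfe a).mul_left _
  have h := layerSum_dilate_congr ψ hneg hper hsign hm hFG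
  rw [mul_comm ((X + 1 : K[X]) ^ (∑ a : S, k a * e a))] at h
  rwa [← dvd_neg, neg_sub] at h

end Depletion

end Summit.BirchSwinnertonDyer.BirchSwinnertonDyer.Theorems.ThetaLayerLambdaCongruenceAtTwo

end
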